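import Mathlib
import Summits.ResolutionOfSingularities.ResolutionOfSingularities.Theorems.WeightedInvariantLocalWeightedDropPolyDescentPrepSeq

/-!
# `WeightedInvariant.LocalWeightedDrop`, stub S3ρ, second key «monic polyhedron descent», piece (ρ-P) `stub_polyPrep`: the `u`-ADIC LIMIT of the
# dissolution sequence is a WELL-PREPARING RE-CENTRING (half B, file 2, def-free — closes `PolyDescent.stub_polyPrep`)

Crux item stmt-ResolutionOfSingularities-8899 `LocalWeightedDrop` (route `ResolutionOfSingularities/WeightedInvariant`), registered skeleton v30
(09f812eb3be8b7d8), stub S3ρ `stub_wildMonicSurfaceReductionWon`; LINE «monic polyhedron descent» of res-L1-w43-lead-1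
(`L/res-L1-w43-lead-1/g3/poly_descent_line_v1.lean` 905148e143a15d9b), sub-stub (ρ-P) `PolyDescent.stub_polyPrep` — SIGNATURE VERBATIM.  [OURS · L1
W4.3, chain w43; (ρ-P) lead res-type-061, second hand res-L1-w43-stub-2.  MODEL: Hironaka's vertex preparation (Cossart–Jannsen–Saito LNM 2270 Ch. 8:
the solvable vertices are dissolved one by one, the re-centrings converge `u`-adically, the limit polygon has no solvable vertex); the degree-2
instance is lead-1's `MonicDescent.monicDescentPrep` (`…MonicDescentPrepExists`, p494822).  Nothing here is a statement of any manuscript.]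

* `coeff_shift_congr` — a coefficient of `WildMonic.shift d A ψ` depends on finitely many coefficients of `ψ`; `bLimT_eq_shift` — THE LIMIT TUPLE
  (`PolyDescent.bLimT`, file 1) IS THE RE-CENTRING BY THE LIMIT SERIES (`PolyDescent.psiLimT`);
* `isPosT_bLimT`; `wellPrepared_bLimT` — a solvable vertex of the limit would be a solvable vertex of every late stage, of fixed degree, while the
  schedule dissolves vertices of least degree and those degrees tend to infinity; `nonSolvVertex_bLimT` — the non-solvable vertices of `A` persist
  with their vertex coefficients;
* `stub_polyPrep` — (ρ-P) VERBATIM: every position has a well-preparing re-centring.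
-/

set_option linter.dupNamespace false -- mandated namespace of this single-conjunct summit

noncomputable section

namespace Summit.ResolutionOfSingularities.ResolutionOfSingularities.Theorems

namespace PolyDescent

open MvPowerSeries MonicDescent WildMonic

variable {k : Type} [Field k] {d : ℕ}

/-! ## A coefficient of the re-centred tuple depends on finitely many coefficients of the re-centring -/

section Congr

variable {R : Type*} [CommRing R]

/-- Products respect agreement of coefficients below an exponent. -/
theorem coeff_mul_congr_le {F F' G G' : MvPowerSeries (Fin 2) R} {D : Fin 2 →₀ ℕ}
    (hF : ∀ g ≤ D, coeff g F = coeff g F') (hG : ∀ g ≤ D, coeff g G = coeff g G') :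
    ∀ g ≤ D, coeff g (F * G) = coeff g (F' * G') := by
  intro g hg
  rw [coeff_mul, coeff_mul]
  refine Finset.sum_congr rfl fun p hp => ?_
  rw [Finset.HasAntidiagonal.mem_antidiagonal] at hp
  rw [hF p.1 (le_trans (by rw [← hp]; exact le_self_add) hg), hG p.2 (le_trans (by rw [← hp]; exact le_add_self) hg)]

/-- Powers respect agreement of coefficients below an exponent. -/
theorem coeff_pow_congr_le {G G' : MvPowerSeries (Fin 2) R} {D : Fin 2 →₀ ℕ} (hG : ∀ g ≤ D, coeff g G = coeff g G') (n : ℕ) :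
    ∀ g ≤ D, coeff g (G ^ n) = coeff g (G' ^ n) := by
  induction n with
  | zero => intro g _; rw [pow_zero, pow_zero]
  | succ n ih => intro g hg; rw [pow_succ, pow_succ]; exact coeff_mul_congr_le ih hG g hg

/-- A COEFFICIENT OF THE RE-CENTRED TUPLE `shift d A ψ` AT `D` DEPENDS ONLY ON THE COEFFICIENTS OF `ψ` AT EXPONENTS `≤ D`. -/
theorem coeff_shift_congr (A : Fin d → MvPowerSeries (Fin 2) R) (ψ ψ' : MvPowerSeries (Fin 2) R) (D : Fin 2 →₀ ℕ)
    (h : ∀ g ≤ D, coeff g ψ = coeff g ψ') (j : Fin d) : coeff D (shift d A ψ j) = coeff D (shift d A ψ' j) := by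
  rw [shift_eq_sum, shift_eq_sum, map_sum, map_sum]
  refine Finset.sum_congr rfl fun n _ => ?_
  exact coeff_mul_congr_le (fun _ _ => rfl) (coeff_pow_congr_le h n) D le_rfl

end Congr

/-- THE LIMIT TUPLE IS THE RE-CENTRING BY THE LIMIT SERIES. -/
theorem bLimT_eq_shift (A : Fin d → MvPowerSeries (Fin 2) k) : bLimT d A = shift d A (psiLimT d A) := by
  classical
  funext j
  ext D
  have hn := agree_of_stageOfT_le A D _ le_rfl
  rw [(hn D le_rfl).2 j, dseqT_eq_shift, coeff_shift_congr A _ (psiLimT d A) D (fun f hf => ((hn f hf).1).symm)]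

/-! ## The limit: zero constant term, position, well prepared, non-solvable vertices persist -/

/-- The limit re-centring has zero constant term (every increment is `−λ u^v` with `|v| ≥ 2`). -/
theorem constantCoeff_psiLimT {A : Fin d → MvPowerSeries (Fin 2) k} (hA : IsPosT d A) : constantCoeff (psiLimT d A) = 0 := by
  classical
  have hzero : ∀ n, coeff (0 : Fin 2 →₀ ℕ) (dpsiT d A n) = 0 := by
    intro n
    induction n with
    | zero => simp
    | succ n ih =>
      rw [dpsiT_succ, map_add, ih, zero_add]
      by_cases hact : DActiveT d A n
      · rw [dincT_of_exists hact, coeff_monomial, if_neg]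
        intro heq
        have h2 := two_le_degree_baseExp_dvertT hA hact
        rw [← heq] at h2
        simp at h2
      · rw [dincT_of_not hact, map_zero]
  rw [← coeff_zero_eq_constantCoeff_apply, coeff_psiLimT A 0 _ le_rfl, hzero]

/-- THE LIMIT TUPLE IS A POSITION. -/
theorem isPosT_bLimT {A : Fin d → MvPowerSeries (Fin 2) k} (hA : IsPosT d A) : IsPosT d (bLimT d A) := by
  classical
  intro j
  have hlt : ((d - (j : ℕ) : ℕ) : ℕ∞) < ((d - (j : ℕ) + 1 : ℕ) : ℕ∞) := by exact_mod_cast Nat.lt_succ_self _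
  refine lt_of_lt_of_le hlt (MvPowerSeries.le_order fun f hf => ?_)
  rw [coeff_bLimT A f j _ le_rfl]
  apply coeff_of_lt_order
  refine lt_of_le_of_lt ?_ (isPosT_dseqT hA _ j)
  have : Finsupp.degree f ≤ d - (j : ℕ) := by have := Nat.cast_lt.mp hf; omega
  exact_mod_cast this

/-- A point of weight `≤ L` for a positive weight lies in the box `[0,L]²`. -/
theorem le_box_of_weight_le {w : Fin 2 → ℕ} (hw : ∀ i, 0 < w i) {L : ℕ} {Q : Fin 2 →₀ ℕ} (hQ : Finsupp.weight w Q ≤ L) :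
    Q ≤ Finsupp.single 0 L + Finsupp.single 1 L := by
  have hwt : Finsupp.weight w Q = w 0 * Q 0 + w 1 * Q 1 := by
    rw [Finsupp.weight_apply, Finsupp.sum_fintype _ _ (by simp)]; simp [Fin.sum_univ_two, mul_comm]
  intro i
  have h0 := hw 0; have h1 := hw 1
  rw [hwt] at hQ
  fin_cases i <;> simp <;> nlinarith

/-- An exponent is below its scaled point. -/
theorem le_slotWeight_smul (j : Fin d) (f : Fin 2 →₀ ℕ) : f ≤ slotWeight d j • f := by
  intro i
  rw [Finsupp.smul_apply, smul_eq_mul]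
  exact Nat.le_mul_of_pos_left _ (slotWeight_pos j)

/-- The exponent carrying a vertex coefficient is below the point. -/
theorem divExp_le (j : Fin d) (P : Fin 2 →₀ ℕ) :
    (Finsupp.single 0 (P 0 / slotWeight d j) + Finsupp.single 1 (P 1 / slotWeight d j) : Fin 2 →₀ ℕ) ≤ P := by
  intro i
  fin_cases i <;> simp [Nat.div_le_self]

/-- Vertex coefficients agree when the slots agree at the carrying exponent. -/
theorem vertexCoeff_eq_of_coeff_eq {A B : Fin d → MvPowerSeries (Fin 2) k} {P : Fin 2 →₀ ℕ} {j : Fin d}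
    (h : coeff (Finsupp.single 0 (P 0 / slotWeight d j) + Finsupp.single 1 (P 1 / slotWeight d j)) (A j) =
      coeff (Finsupp.single 0 (P 0 / slotWeight d j) + Finsupp.single 1 (P 1 / slotWeight d j)) (B j)) :
    vertexCoeff d A P j = vertexCoeff d B P j := by
  by_cases hdvd : ∀ i, slotWeight d j ∣ P i
  · rw [vertexCoeff_of_dvd A hdvd, vertexCoeff_of_dvd B hdvd, h]
  · rw [vertexCoeff_of_not_dvd A hdvd, vertexCoeff_of_not_dvd B hdvd]

/-- THE LIMIT TUPLE IS WELL PREPARED: a solvable vertex of the limit would be a solvable vertex of every late stage, of fixed degree — but the schedule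
dissolves vertices of least degree and those degrees tend to infinity. -/
theorem wellPrepared_bLimT (A : Fin d → MvPowerSeries (Fin 2) k) : WellPrepared d (bLimT d A) := by
  classical
  intro P hPv hsol
  obtain ⟨hPmem, w, hw, hmin⟩ := hPv
  set L := Finsupp.weight w P with hL
  obtain ⟨N, hN⟩ := eventually_degree_dvertT_gt A (Finsupp.degree P)
  set n := max (stageOfT d A (Finsupp.single 0 L + Finsupp.single 1 L)) N with hn
  have hagree : ∀ f : Fin 2 →₀ ℕ, f ≤ Finsupp.single 0 L + Finsupp.single 1 L →
      ∀ j : Fin d, coeff f (bLimT d A j) = coeff f (dseqT d A n j) :=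
    fun f hf j => ((agree_of_stageOfT_le A _ n (le_max_left _ _) f hf).2 j)
  have hPbox : P ≤ Finsupp.single 0 L + Finsupp.single 1 L := le_box_of_weight_le hw le_rfl
  -- membership in a Newton set for points in the box transfers between the limit and stage `n`
  have htrans : ∀ Q : Fin 2 →₀ ℕ, Finsupp.weight w Q ≤ L → (Q ∈ newtonSet (bLimT d A) ↔ Q ∈ newtonSet (dseqT d A n)) := by
    intro Q hQ
    have hQbox := le_box_of_weight_le hw hQ
    simp only [WildMonic.mem_newtonSet_iff]
    constructor
    · rintro ⟨j, f, hf, rfl⟩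
      exact ⟨j, f, by rwa [← hagree f (le_trans (le_slotWeight_smul j f) hQbox) j], rfl⟩
    · rintro ⟨j, f, hf, rfl⟩
      exact ⟨j, f, by rwa [hagree f (le_trans (le_slotWeight_smul j f) hQbox) j], rfl⟩
  -- `P` is a solvable vertex of stage `n`
  have hvc : ∀ j : Fin d, vertexCoeff d (dseqT d A n) P j = vertexCoeff d (bLimT d A) P j :=
    fun j => vertexCoeff_eq_of_coeff_eq (hagree _ (le_trans (divExp_le j P) hPbox) j).symm
  have hsoln : Solvable d (dseqT d A n) P := (solvable_iff_of_vertexCoeff_eq hvc).mpr hsol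
  have hPn : P ∈ newtonSet (dseqT d A n) := (htrans P le_rfl).mp hPmem
  have hminn : ∀ Q ∈ newtonSet (dseqT d A n), Q ≠ P → Finsupp.weight w P < Finsupp.weight w Q := by
    intro Q hQ hQP
    by_contra hle
    push Not at hle
    exact absurd (hmin Q ((htrans Q hle).mpr hQ) hQP) (not_lt.mpr hle)
  have hsv : IsSolvVertex d (dseqT d A n) P := ⟨⟨hPn, w, hw, hminn⟩, hsoln⟩
  have hact : DActiveT d A n := ⟨P, hsv⟩
  have hle := (dvertT_spec hact).2 P hsv
  have hgt := hN n (le_max_right _ _) hact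
  omega

/-- NON-SOLVABLE VERTICES OF THE ORIGINAL TUPLE PERSIST in the limit, with all their vertex coefficients. -/
theorem nonSolvVertex_bLimT (A : Fin d → MvPowerSeries (Fin 2) k) {P : Fin 2 →₀ ℕ}
    (hPv : IsVertex (newtonSet A) P) (hPns : ¬ Solvable d A P) :
    IsVertex (newtonSet (bLimT d A)) P ∧ ∀ j : Fin d, vertexCoeff d (bLimT d A) P j = vertexCoeff d A P j := by
  classical
  obtain ⟨hPmem, w, hw, hmin⟩ := hPv
  have hstage := fun n => nonSolvVertex_dseqT hPmem hPns w hmin n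
  have hcoef : ∀ j : Fin d, vertexCoeff d (bLimT d A) P j = vertexCoeff d A P j := by
    intro j
    refine (vertexCoeff_eq_of_coeff_eq (coeff_bLimT A _ j _ le_rfl)).trans ?_
    exact ((hstage _).1 j)
  refine ⟨⟨?_, w, hw, fun Q hQ hQP => ?_⟩, hcoef⟩
  · obtain ⟨j, hj⟩ := exists_vertexCoeff_ne_zero_of_mem hPmem
    exact mem_newtonSet_of_vertexCoeff_ne_zero (j := j) (by rw [hcoef j]; exact hj)
  · obtain ⟨j, f, hf, rfl⟩ := hQ
    have hQn : slotWeight d j • f ∈ newtonSet (dseqT d A (stabNT d A f)) :=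
      ⟨j, f, by rwa [← coeff_bLimT A f j _ le_rfl], rfl⟩
    exact (hstage _).2.2 _ hQn hQP

/-- PIECE (ρ-P) — HIRONAKA'S VERTEX PREPARATION for `y^d + Σ_{j<d} A_j y^j` over `k[[u₁,u₂]]` (any field `k`): EVERY POSITION HAS A WELL-PREPARING
RE-CENTRING (the `u`-adic limit of vertex dissolution scheduled by least degree).  Signature verbatim from the line file `poly_descent_line_v1.lean`
(`stub_polyPrep`); consumed by `stub_polyNoChain` / `stub_polyBridge` / `wildMonicSurfaceReductionWon_of_polyDescent`. -/
theorem stub_polyPrep : ∀ (k : Type) [Field k] (d : ℕ), 0 < d → ∀ A : Fin d → MvPowerSeries (Fin 2) k, IsPosT d A →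
    ∃ ψ : MvPowerSeries (Fin 2) k, IsPrepRecentring d A ψ := by
  intro k _ d _ A hA
  refine ⟨psiLimT d A, constantCoeff_psiLimT hA, ?_⟩
  rw [← bLimT_eq_shift]
  exact ⟨isPosT_bLimT hA, wellPrepared_bLimT A, fun P hPv hPns => nonSolvVertex_bLimT A hPv hPns⟩

end PolyDescent

end Summit.ResolutionOfSingularities.ResolutionOfSingularities.Theorems

end
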